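import Literature.Probability.LatticeModels.InterfaceRearrangement
import Literature.Probability.LatticeModels.FermionicObservableSums
import HarnessLib

/-!
# Smirnov's weight table for the FK-Ising observable: constants, arrivals, and the per-pair algebra

Topic `Literature/Probability/LatticeModels`; seventh instalment of the discharge programme for
crit-ising.S18, node 1 (s-holomorphicity, corrected form
`isSHolomorphic_fkIsingObservable_of_zdArcA_connected`). Smirnov's proof of Lemma 4.5 (Ann.
Math. 172 (2010), §4) pairs `ω` with `ω ∪ {e}` and checks, case by case, that the pair contributes
equally to the "antipodal sums"; this file supplies everything of that computation that is not
the case analysis itself (`InterfaceRearrangement.lean`) — all proved — and states the two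
planar-topology inputs as named facts:

* `bcBondConfig_liftConfig_insert`, `toggle_hypotheses`: completing `ω ∪ {e}` opens exactly `e`
  on top of the completion of `ω` (for an interior edge `e`), i.e. the hypotheses of the toggling
  lemmas hold for the pair;
* `medialCycle_turning` (**T2**, named fact; Hopf's Umlaufsatz for the cycles of the turning
  rule: `∑ turnSign = ±4` around a cycle of minimal period) and `medialCycle_separates` (**T1**,
  named fact; planar duality: if the two corners arriving at a closed edge lie on different
  cycles, its endpoints are not joined by open edges);
* the constants `σ = eighthPhase 1 = e^{-iπ/8}` (Smirnov's `σ`, eq. (4.3)), `κ = (σ + σ̄)/2 = cos(π/8)`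
  kept in exponential form, `quarterPhase n = eighthPhase (2n)`, and the single trigonometric
  input `√2 · e^{iπ/4} = 1 + i` (`sqrt_two_eq`: `√2 = (1 + E(-4)) E(2)`);
* `passageSum_cTgt`: the passages of the exploration through the interior medial vertex
  `e = cTgt p` are the arrivals of its darts at `e` (times `j + 1` with `orb j ∈ {p, partner p}`),
  with weight `eighthPhase (2 C_j + s_j)` (`C_j = turnCount j`, `s_j = turnSign (orb j)`), from
  `windingAt_explorationList`;
* turn-count bookkeeping along pieces of orbits (`turnCount_add`, `turnCount_congr_prefix`);
* **the table** (`table_case2`, `table_case1`, `table_case2_out`, `table_case1_out`): with `a` the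
  weight of the first arrival, the contributions of the pair to "arrivals minus `κ` times
  passages" (and "departures minus `κ` times passages") cancel, given the relative weights `√2`
  (case 2: the second corner is excised, `x ~ y`) and `1/√2` (case 1: the partner's loop is
  spliced in, `x ≁ y` by T1) of `rcWeight_insert_critical`, and the phases `E(-4) = i`,
  `E(4) = -i` of the second arrival (odd rotation number, T2). These are identities in the ring
  generated by the `E(m)`, proved by `linear_combination` from `E(m)E(n) = E(m+n)`.

The summation over pairs (`sum_powerset_pair`) and the projection step
(`FermionicObservableSums`: lines, `cornerLine`, `projLine_mul_mul`) that turn these into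
`IsSHolomorphic` are the next (final) instalment of node 1.
-/

noncomputable section

namespace Literature.Probability.LatticeModels

open Finset

namespace DiscreteDobrushin

variable {D : DiscreteDobrushin}

/-- Membership of a lattice edge in a lifted configuration: `e ∈ ι ω` iff `e` is the image of an
edge of `ω`. [cite: Smirnov2010, §2] -/
theorem mem_liftConfig_iff {ω : Finset (Sym2 (meshDomain D.Ω D.δ))} {e : Sym2 (Site 2)} :
    e ∈ liftConfig D.Ω D.δ ω ↔ ∃ e' ∈ ω, Sym2.map Subtype.val e' = e := by
  simp [liftConfig]

/-- `Sym2.map Subtype.val` is injective. [folklore] -/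
theorem sym2_map_val_injective : Function.Injective (Sym2.map (Subtype.val : meshDomain D.Ω D.δ → Site 2)) :=
  Sym2.map.injective Subtype.val_injective

/-- **The completed configuration under opening one interior edge.** If `e` is an edge of the
interface graph (an edge of `Ω_δ` with no endpoint on the arc `B`) whose endpoints are not both on
the arc `A`, then completing `ω ∪ {e}` opens exactly `e` in addition to the completion of `ω`.
[cite: Smirnov2010, proof of Lemma 4.5] -/
theorem bcBondConfig_liftConfig_insert [DecidableEq (Sym2 (meshDomain D.Ω D.δ))]
    {ω : Finset (Sym2 (meshDomain D.Ω D.δ))} {e : Sym2 (meshDomain D.Ω D.δ)}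
    (he : Sym2.map Subtype.val e ∈ (discreteDomainGraph D.Ω D.δ).edgeSet)
    (hB : ∀ x ∈ Sym2.map Subtype.val e, x ∉ D.zdArcB) :
    D.bcBondConfig (liftConfig D.Ω D.δ (insert e ω)) =
      insert (Sym2.map Subtype.val e) (D.bcBondConfig (liftConfig D.Ω D.δ ω)) := by
  ext f
  simp only [mem_bcBondConfig_iff, Set.mem_insert_iff, liftConfig_insert]
  constructor
  · rintro ⟨hf, hA | ⟨hfω, hfB⟩⟩
    · exact Or.inr ⟨hf, Or.inl hA⟩
    · rcases hfω with rfl | hfω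
      · exact Or.inl rfl
      · exact Or.inr ⟨hf, Or.inr ⟨hfω, hfB⟩⟩
  · rintro (rfl | ⟨hf, hA | ⟨hfω, hfB⟩⟩)
    · exact ⟨he, Or.inr ⟨Set.mem_insert _ _, hB⟩⟩
    · exact ⟨hf, Or.inl hA⟩
    · exact ⟨hf, Or.inr ⟨Set.mem_insert_of_mem _ hfω, hfB⟩⟩

/-- If moreover `e ∉ ω` and its endpoints are not both on the arc `A`, then `e` is closed in the
completion of `ω`. [cite: Smirnov2010, proof of Lemma 4.5] -/
theorem map_not_mem_bcBondConfig_liftConfig {ω : Finset (Sym2 (meshDomain D.Ω D.δ))} {e : Sym2 (meshDomain D.Ω D.δ)}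
    (heω : e ∉ ω) (hA : ¬ ∀ x ∈ Sym2.map Subtype.val e, x ∈ D.zdArcA) :
    Sym2.map Subtype.val e ∉ D.bcBondConfig (liftConfig D.Ω D.δ ω) := by
  rintro ⟨-, hA' | ⟨hω, -⟩⟩
  · exact hA hA'
  · rw [mem_liftConfig_iff] at hω
    obtain ⟨e', he', hee'⟩ := hω
    rw [sym2_map_val_injective hee'] at he'
    exact heω he'

/-- The two hypotheses of the toggling lemmas (`nextCorner_toggle`, `cornerOrbit_toggle_case*`)
for the pair `ω`, `ω ∪ {e}`: the completions agree off `e` and differ at `e`.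
[cite: Smirnov2010, proof of Lemma 4.5] -/
theorem toggle_hypotheses [DecidableEq (Sym2 (meshDomain D.Ω D.δ))]
    {ω : Finset (Sym2 (meshDomain D.Ω D.δ))} {e : Sym2 (meshDomain D.Ω D.δ)}
    (he : Sym2.map Subtype.val e ∈ (discreteDomainGraph D.Ω D.δ).edgeSet)
    (hB : ∀ x ∈ Sym2.map Subtype.val e, x ∉ D.zdArcB) (hA : ¬ ∀ x ∈ Sym2.map Subtype.val e, x ∈ D.zdArcA)
    (heω : e ∉ ω) {p : Site 2 × Fin 4} (hp : cTgt p = Sym2.map Subtype.val e) :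
    (∀ f, f ≠ cTgt p → (f ∈ D.bcBondConfig (liftConfig D.Ω D.δ (insert e ω)) ↔ f ∈ D.bcBondConfig (liftConfig D.Ω D.δ ω))) ∧
      ¬ (cTgt p ∈ D.bcBondConfig (liftConfig D.Ω D.δ (insert e ω)) ↔ cTgt p ∈ D.bcBondConfig (liftConfig D.Ω D.δ ω)) := by
  rw [bcBondConfig_liftConfig_insert he hB, hp]
  refine ⟨fun f hf => ⟨fun h => (Set.mem_insert_iff.1 h).resolve_left hf, fun h => Set.mem_insert_of_mem _ h⟩, fun h => ?_⟩
  exact map_not_mem_bcBondConfig_liftConfig heω hA (h.1 (Set.mem_insert _ _))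

end DiscreteDobrushin

/-! ### The two planar-topology inputs, as named facts -/

/-- **Umlaufsatz for cycles of the turning rule** (H. Hopf, *Über die Drehung der Tangenten und
Sehnen ebener Kurven*, Compositio Math. 2 (1935) 50–62: the tangent of a simple closed plane
curve turns by `±2π`; here for the rounded/perturbed medial cycles of Smirnov 2010, §4, Fig. 5,
which are simple closed curves turning by `±π/2` at every step). For every bond configuration
`β` and every cycle of `nextCorner β` of minimal period `Q` through the corner `q`, the signed
number of quarter turns around the cycle, `∑_{m<Q} turnSign β (orb m)` (`+1` = left = crossing a
closed edge, `-1` = right = following an open one), is `4` or `-4`. Named fact (planar topology,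
not yet formalised here; the perturbed polygon of `MedialPerturbation.lean` and the argument
increments of `Topology/PlaneTopology/ArgumentIncrement.lean` are the intended route). Only its
residue modulo `8` is used below (the spinor sign). [cite: Hopf1935, Satz I] -/
def medialCycle_turning : Prop :=
  ∀ (β : Percolation.BondConfig (Site 2)) (q : Site 2 × Fin 4) (Q : ℕ), 0 < Q → cornerOrbit β q Q = q →
    (∀ s, 0 < s → s < Q → cornerOrbit β q s ≠ q) →
    (∑ m ∈ Finset.range Q, turnSign β (cornerOrbit β q m) = 4 ∨
      ∑ m ∈ Finset.range Q, turnSign β (cornerOrbit β q m) = -4)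

/-- **Separation by a cycle of the turning rule** (planar duality of the loop representation;
folklore, e.g. Grimmett, *The Random-Cluster Model* (2006), §6.1, "each loop separates an open
cluster from a dual open cluster"; proved in print from the Jordan curve theorem). Let `β` be a
configuration of lattice edges and `e = cTgt p` a closed lattice edge, with `p` at the endpoint
`x` and its partner `p₂` at the other endpoint `y` (the two corners arriving at `e`). If the
cycle of `nextCorner β` through `p₂` is finite and does not contain `p`, then `x` and `y` are not
joined by a path of open edges: the loop through `p₂` crosses the segment `[x, y]` exactly once
and crosses no open edge. Named fact (intended route: winding numbers of the perturbed polygon,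
`crossInc_loop` of `ArgumentIncrement.lean`). [folklore] -/
def medialCycle_separates : Prop :=
  ∀ (β : Percolation.BondConfig (Site 2)), β ⊆ (zdGraph 2).edgeSet → ∀ (p : Site 2 × Fin 4), cTgt p ∉ β →
    ∀ (Q : ℕ), 0 < Q → cornerOrbit β (cornerPartner p) Q = cornerPartner p →
    (∀ m, cornerOrbit β (cornerPartner p) m ≠ p) →
    ¬ (Percolation.openGraph β).Reachable p.1 (p.1 + cornerUnit (p.2 + 1))

/-! ### Eighth-turn phases: `σ = e^{-iπ/8}` and the constant `κ = cos (π/8) = (σ + σ̄)/2` -/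

section Eighth

open Complex

/-- The phase of `m` eighth-turns with spin `1/2`: `e^{-iπ m/8}`; `σ = eighthPhase 1` is Smirnov's
`σ = exp(-iπ/8)` (eq. (4.3)), and `quarterPhase n = eighthPhase (2n)`. [cite: Smirnov2010, §4 eq. (4.3)] -/
def eighthPhase (m : ℤ) : ℂ := exp (-(Real.pi / 8 * m) * I)

/-- `eighthPhase` is additive-to-multiplicative. [cite: Smirnov2010, §4] -/
theorem eighthPhase_add (m n : ℤ) : eighthPhase (m + n) = eighthPhase m * eighthPhase n := by
  rw [eighthPhase, eighthPhase, eighthPhase, ← exp_add]; congr 1; push_cast; ring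

/-- `eighthPhase 0 = 1`. [cite: Smirnov2010, §4] -/
@[simp] theorem eighthPhase_zero : eighthPhase 0 = 1 := by simp [eighthPhase]

/-- `quarterPhase n = eighthPhase (2 n)`. [cite: Smirnov2010, §4] -/
theorem quarterPhase_eq_eighthPhase (n : ℤ) : quarterPhase n = eighthPhase (2 * n) := by
  rw [quarterPhase, eighthPhase]; congr 1; push_cast; ring

/-- `eighthPhase (-4) = I` (a quarter turn to the right... `e^{iπ/2}`). [cite: Smirnov2010, §4] -/
theorem eighthPhase_neg_four : eighthPhase (-4) = I := by
  rw [eighthPhase, show -(Real.pi / 8 * ((-4 : ℤ) : ℂ)) * I = Real.pi / 2 * I by push_cast; ring, exp_pi_div_two_mul_I]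

/-- `eighthPhase 4 = -I`. [cite: Smirnov2010, §4] -/
theorem eighthPhase_four : eighthPhase 4 = -I := by
  have h := eighthPhase_add 4 (-4)
  rw [show (4 : ℤ) + -4 = 0 by norm_num, eighthPhase_zero, eighthPhase_neg_four] at h
  have : eighthPhase 4 = I⁻¹ := eq_inv_of_mul_eq_one_left h.symm
  rw [this, inv_I]

/-- **`1 + I = √2 · e^{iπ/4}`**, i.e. `√2 · eighthPhase (-2) = 1 + I` (the only trigonometric
input of the weight table: `cos (π/4) = sin (π/4) = √2/2`). [folklore] -/
theorem sqrt_two_mul_eighthPhase_neg_two : (Real.sqrt 2 : ℂ) * eighthPhase (-2) = 1 + I := by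
  rw [eighthPhase, show -(Real.pi / 8 * ((-2 : ℤ) : ℂ)) * I = ((Real.pi / 4 : ℝ) : ℂ) * I by push_cast; ring,
    exp_mul_I, ← Complex.ofReal_cos, ← Complex.ofReal_sin, Real.cos_pi_div_four, Real.sin_pi_div_four]
  apply Complex.ext <;> simp <;> ring_nf <;> norm_num

/-- Smirnov's normalising constant `κ = cos (π/8) = (σ + σ̄)/2`, kept in the exponential form in
which the weight table closes up algebraically. [cite: Smirnov2010, §4 (definition of F(v))] -/
def kappa : ℂ := (eighthPhase 1 + eighthPhase (-1)) / 2

end Eighth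


/-! ### Passages through an interior medial vertex = arrivals of darts at it -/

section Arrivals

variable {D : DiscreteDobrushin} {ω : Percolation.BondConfig (Site 2)} {c₀ p : Site 2 × Fin 4}

local notation "β" => D.bcBondConfig ω
local notation "orb" => cornerOrbit (D.bcBondConfig ω) c₀

/-- The exponential weight of a passage: `exp (-i · ½ · windingAt (j+1)) = eighthPhase (2 C_j + s_j)` for
`j + 1 < N`, where `C_j = turnCount j`, `s_j = turnSign (orb j)`. [cite: Smirnov2010, §2.2 eq. (2.2)] -/
theorem exp_windingAt_succ (hδ : D.δ ≠ 0) {j N : ℕ} (hj : j + 1 < N) :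
    Complex.exp (-Complex.I * (1 / 2 : ℝ) * (windingAt (explorationList β c₀ N) D.δ (j + 1) : ℝ)) =
      eighthPhase (2 * turnCount β c₀ j + turnSign β (orb j)) := by
  rw [windingAt_explorationList hδ c₀ hj, Nat.add_sub_cancel, sum_turnOf_eq, sum_turnOf_eq, eighthPhase]
  congr 1
  have h1 : (∑ i ∈ Finset.range (j + 1), (turnSign β (orb i) : ℝ)) =
      (turnCount β c₀ j : ℝ) + (turnSign β (orb j) : ℝ) := by
    rw [Finset.sum_range_succ, turnCount]; push_cast; rfl
  have h0 : (∑ i ∈ Finset.range j, (turnSign β (orb i) : ℝ)) = (turnCount β c₀ j : ℝ) := by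
    rw [turnCount]; push_cast; rfl
  rw [h1, h0]
  push_cast
  ring

/-- **Passages of the exploration through the interior medial vertex `e = cTgt p` are the arrivals
of its darts at `e`**: positions `j + 1` with `orb j ∈ {p, partner p}`; so the passage sum of the
observable at `e` is `∑ eighthPhase (2 C_j + s_j)` over those `j < N`. "Interior" is used through:
no endpoint of `e` lies on the arc `B` (which excludes the first and last vertices `e_a`, `e_b`).
[cite: Smirnov2010, §2.2 eq. (2.2) and §4 (definition of F(v))] -/
theorem passageSum_cTgt (hD : D.IsZdAdmissible) (hc₀ : D.IsStartCorner c₀) {N : ℕ}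
    (hN : ¬ D.IsInnerFace (cFace (orb N))) (hlt : ∀ k < N, D.IsInnerFace (cFace (orb k)))
    (hB : ∀ x ∈ cTgt p, x ∉ D.zdArcB) :
    passageSum (explorationList β c₀ N) D.δ (1 / 2) (cTgt p) =
      ∑ j ∈ (Finset.range N).filter (fun j => orb j = p ∨ orb j = cornerPartner p),
        eighthPhase (2 * turnCount β c₀ j + turnSign β (orb j)) := by
  classical
  have hδ : D.δ ≠ 0 := hD.delta_pos.ne'
  obtain ⟨M, rfl⟩ : ∃ M, N = M + 1 := ⟨N - 1, (Nat.succ_pred_eq_of_pos (Nat.pos_of_ne_zero fun h => by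
    subst h; exact hN hc₀.isOutEdge.1)).symm⟩
  rw [passageSum_explorationList]
  -- position 0 (source `e_a`) and position `M + 1` (source `e_b`) are not passages through `e`
  have h0 : cSrc (orb 0) ≠ cTgt p := fun h => by
    rw [cornerOrbit_zero] at h
    exact hB _ (h ▸ Sym2.mem_mk_right _ _) hc₀.mem_zdArcB
  have hlast : cSrc (orb (M + 1)) ≠ cTgt p := fun h => by
    rw [cSrc_cornerOrbit_succ] at h
    obtain ⟨-, -, hBe, -⟩ := cornerOrbit_exit hD hc₀ (hlt M (Nat.lt_succ_self M)) hN
    exact hB _ (h ▸ Sym2.mem_mk_right _ _) hBe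
  -- reindex the passages `k = j + 1`, `j < M + 1`... with `j + 1 ≤ M`
  have hfilter : (Finset.range (M + 1 + 1)).filter (fun k => cSrc (orb k) = cTgt p) =
      ((Finset.range (M + 1)).filter (fun j => orb j = p ∨ orb j = cornerPartner p)).image (· + 1) := by
    ext k
    simp only [Finset.mem_filter, Finset.mem_range, Finset.mem_image]
    constructor
    · rintro ⟨hk, hke⟩
      obtain ⟨j, rfl⟩ : ∃ j, k = j + 1 := ⟨k - 1, by
        rcases k with _ | k
        · exact absurd hke h0
        · simp⟩
      refine ⟨j, ⟨by omega, ?_⟩, rfl⟩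
      rw [cSrc_cornerOrbit_succ] at hke
      exact cTgt_eq_cTgt_iff.1 hke
    · rintro ⟨j, ⟨hj, hjp⟩, rfl⟩
      refine ⟨by omega, ?_⟩
      rw [cSrc_cornerOrbit_succ]
      exact cTgt_eq_cTgt_iff.2 hjp
  rw [hfilter, Finset.sum_image (fun _ _ _ _ h => Nat.succ_injective h)]
  refine Finset.sum_congr rfl fun j hj => ?_
  rw [Finset.mem_filter, Finset.mem_range] at hj
  -- `j + 1 < M + 1`: the last dart `orb M` arrives at `e_b ≠ e`
  have hjM : j + 1 < M + 1 := by
    rcases Nat.lt_or_ge j M with h | h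
    · omega
    · exfalso
      have hjM : j = M := by omega
      subst hjM
      apply hlast
      rw [cSrc_cornerOrbit_succ]
      exact cTgt_eq_cTgt_iff.2 hj.2
  exact exp_windingAt_succ hδ hjM

end Arrivals


/-! ### Turn counts along pieces of orbits -/

section TurnCounts

variable {β₁ β₂ : Percolation.BondConfig (Site 2)} {c : Site 2 × Fin 4}

/-- Turn counts add along the orbit: `C_{a+b} = C_a + ∑_{m<b} s_{a+m}`. [cite: Smirnov2010, §4] -/
theorem turnCount_add (β₀ : Percolation.BondConfig (Site 2)) (c₀ : Site 2 × Fin 4) (a b : ℕ) :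
    turnCount β₀ c₀ (a + b) = turnCount β₀ c₀ a + ∑ m ∈ Finset.range b, turnSign β₀ (cornerOrbit β₀ c₀ (a + m)) := by
  rw [turnCount, turnCount, Finset.sum_range_add]

/-- Turn signs agree for two configurations that agree at the target edge. [cite: Smirnov2010, §4] -/
theorem turnSign_congr {q : Site 2 × Fin 4} (h : cTgt q ∈ β₁ ↔ cTgt q ∈ β₂) : turnSign β₁ q = turnSign β₂ q := by
  classical
  unfold turnSign
  by_cases h1 : cTgt q ∈ β₁
  · rw [if_pos h1, if_pos (h.1 h1)]
  · rw [if_neg h1, if_neg (fun h2 => h1 (h.2 h2))]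

/-- **Equal prefixes have equal turn counts**: if two orbits from `c` agree up to time `i` and the
two configurations agree at the target edges of the corners before time `i`, the turn counts at
time `i` agree. [cite: Smirnov2010, §4] -/
theorem turnCount_congr_prefix {i : ℕ} (horb : ∀ j ≤ i, cornerOrbit β₁ c j = cornerOrbit β₂ c j)
    (htgt : ∀ j < i, (cTgt (cornerOrbit β₂ c j) ∈ β₁ ↔ cTgt (cornerOrbit β₂ c j) ∈ β₂)) :
    turnCount β₁ c i = turnCount β₂ c i := by
  rw [turnCount, turnCount]
  refine Finset.sum_congr rfl fun j hj => ?_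
  rw [Finset.mem_range] at hj
  rw [horb j hj.le]
  exact turnSign_congr (htgt j hj)

/-- The turn sign at a corner arriving at a closed edge is `+1` (crossing = left turn). [cite: Smirnov2010, §4] -/
theorem turnSign_of_not_mem {β₀ : Percolation.BondConfig (Site 2)} {q : Site 2 × Fin 4} (h : cTgt q ∉ β₀) :
    turnSign β₀ q = 1 := by
  classical
  unfold turnSign; rw [if_neg h]

/-- The turn sign at a corner arriving at an open edge is `-1` (following = right turn). [cite: Smirnov2010, §4] -/
theorem turnSign_of_mem {β₀ : Percolation.BondConfig (Site 2)} {q : Site 2 × Fin 4} (h : cTgt q ∈ β₀) :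
    turnSign β₀ q = -1 := by
  classical
  unfold turnSign; rw [if_pos h]

end TurnCounts

/-! ### The algebra of the weight table (Smirnov 2010, proof of Lemma 4.5) -/

section Table

open Complex

/-- `eighthPhase` has period `16`. [cite: Smirnov2010, §4] -/
theorem eighthPhase_add_sixteen (m : ℤ) : eighthPhase (m + 16) = eighthPhase m := by
  rw [eighthPhase_add, show (16 : ℤ) = 4 + 4 + 4 + 4 by norm_num, eighthPhase_add, eighthPhase_add, eighthPhase_add,
    eighthPhase_four]
  have : (-I) * (-I) * (-I) * (-I) = (I * I) * (I * I) := by ring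
  rw [this, I_mul_I]; norm_num

/-- `eighthPhase (m + 16 k) = eighthPhase m`. [cite: Smirnov2010, §4] -/
theorem eighthPhase_add_sixteen_mul (m k : ℤ) : eighthPhase (m + 16 * k) = eighthPhase m := by
  induction k using Int.induction_on with
  | zero => simp
  | succ k ih => rw [show m + 16 * ((k : ℤ) + 1) = (m + 16 * k) + 16 by ring, eighthPhase_add_sixteen, ih]
  | pred k ih =>
    have := eighthPhase_add_sixteen (m + 16 * (-(k : ℤ) - 1))
    rw [show m + 16 * (-(k : ℤ) - 1) + 16 = m + 16 * -(k : ℤ) by ring, ih] at this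
    exact this.symm

/-- `√2 = (1 + I) · eighthPhase 2 = (1 + eighthPhase (-4)) · eighthPhase 2`. [folklore] -/
theorem sqrt_two_eq : (Real.sqrt 2 : ℂ) = (1 + eighthPhase (-4)) * eighthPhase 2 := by
  rw [eighthPhase_neg_four, ← sqrt_two_mul_eighthPhase_neg_two, mul_assoc, ← eighthPhase_add]
  norm_num

/-- **Case 2 of the table closes up**: with `a` the weight of the first arrival, `a · eighthPhase (-4)`
that of the second (odd rotation number of the excised loop), both crossing (`s = +1`) in `ω`, and
`√2`-times the single following arrival (`s = -1`) in `ω ∪ e`: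
`a(1 - κσ) + a E(-4) (1 - κσ) + √2 a (1 - κσ̄) = 0`. [cite: Smirnov2010, proof of Lemma 4.5 (the table)] -/
theorem table_case2 (a : ℂ) :
    a * (1 - kappa * eighthPhase 1) + a * eighthPhase (-4) * (1 - kappa * eighthPhase 1) +
      (Real.sqrt 2 : ℂ) * (a * (1 - kappa * eighthPhase (-1))) = 0 := by
  rw [sqrt_two_eq, kappa]
  have h2 : eighthPhase 2 = eighthPhase 1 * eighthPhase 1 := by rw [← eighthPhase_add]; norm_num
  have h0 : eighthPhase 1 * eighthPhase (-1) = 1 := by rw [← eighthPhase_add]; norm_num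
  have h3 : eighthPhase 2 * eighthPhase (-1) = eighthPhase 1 := by rw [← eighthPhase_add]; norm_num
  linear_combination (a * (1 + eighthPhase (-4))) * h2 - (a * (1 + eighthPhase (-4))) * h0 -
    (a * (1 + eighthPhase (-4)) * (eighthPhase 1 + eighthPhase (-1)) / 2) * h3

/-- **Case 1 of the table closes up**: a single crossing arrival `a` in `ω` against, in `ω ∪ e`
(weight `1/√2` relative), the following arrival `a` and the second following arrival
`a · eighthPhase 4` after the spliced loop (odd rotation number):
`√2 · a(1 - κσ) + a(1 - κσ̄) + a E(4) (1 - κσ̄) = 0`. [cite: Smirnov2010, proof of Lemma 4.5 (the table)] -/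
theorem table_case1 (a : ℂ) :
    (Real.sqrt 2 : ℂ) * (a * (1 - kappa * eighthPhase 1)) +
      (a * (1 - kappa * eighthPhase (-1)) + a * eighthPhase 4 * (1 - kappa * eighthPhase (-1))) = 0 := by
  rw [sqrt_two_eq, kappa]
  have h2 : eighthPhase 2 = eighthPhase 1 * eighthPhase 1 := by rw [← eighthPhase_add]; norm_num
  have h0 : eighthPhase 1 * eighthPhase (-1) = 1 := by rw [← eighthPhase_add]; norm_num
  have h5 : eighthPhase (-1) * eighthPhase (-1) = eighthPhase (-2) := by rw [← eighthPhase_add]; norm_num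
  have h7 : eighthPhase 2 * eighthPhase 2 = eighthPhase 4 := by rw [← eighthPhase_add]; norm_num
  have h6 : eighthPhase (-4) * eighthPhase 2 = eighthPhase (-2) := by rw [← eighthPhase_add]; norm_num
  have h8 : eighthPhase (-2) * eighthPhase 2 = 1 := by rw [← eighthPhase_add]; norm_num
  have h9 : eighthPhase 4 * eighthPhase (-2) = eighthPhase 2 := by rw [← eighthPhase_add]; norm_num
  linear_combination (a / 2) * ((1 + eighthPhase (-4)) * eighthPhase 2 * h2 -
    ((1 + eighthPhase (-4)) * eighthPhase 2 + 1 + eighthPhase 4) * h0 - (1 + eighthPhase 4) * h5 - h7 +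
    (1 - eighthPhase 2) * h6 - h8 - h9)

/-- Case 2, outgoing darts: `a(E2 - κσ) + a E(-4)(E2 - κσ) + √2 a (E(-2) - κσ̄) = 0`.
[cite: Smirnov2010, proof of Lemma 4.5 (the table)] -/
theorem table_case2_out (a : ℂ) :
    a * (eighthPhase 2 - kappa * eighthPhase 1) + a * eighthPhase (-4) * (eighthPhase 2 - kappa * eighthPhase 1) +
      (Real.sqrt 2 : ℂ) * (a * (eighthPhase (-2) - kappa * eighthPhase (-1))) = 0 := by
  rw [sqrt_two_eq, kappa]
  have h2 : eighthPhase 2 = eighthPhase 1 * eighthPhase 1 := by rw [← eighthPhase_add]; norm_num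
  have h0 : eighthPhase 1 * eighthPhase (-1) = 1 := by rw [← eighthPhase_add]; norm_num
  have h3 : eighthPhase 2 * eighthPhase (-1) = eighthPhase 1 := by rw [← eighthPhase_add]; norm_num
  have h8 : eighthPhase (-2) * eighthPhase 2 = 1 := by rw [← eighthPhase_add]; norm_num
  linear_combination (a * (1 + eighthPhase (-4))) * (h2 - h0 - (eighthPhase 1 + eighthPhase (-1)) / 2 * h3 + h8)

/-- Case 1, outgoing darts: `√2 a (E2 - κσ) + a(E(-2) - κσ̄) + a E(4)(E(-2) - κσ̄) = 0`.
[cite: Smirnov2010, proof of Lemma 4.5 (the table)] -/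
theorem table_case1_out (a : ℂ) :
    (Real.sqrt 2 : ℂ) * (a * (eighthPhase 2 - kappa * eighthPhase 1)) +
      (a * (eighthPhase (-2) - kappa * eighthPhase (-1)) +
        a * eighthPhase 4 * (eighthPhase (-2) - kappa * eighthPhase (-1))) = 0 := by
  rw [sqrt_two_eq, kappa]
  have h2 : eighthPhase 2 = eighthPhase 1 * eighthPhase 1 := by rw [← eighthPhase_add]; norm_num
  have h0 : eighthPhase 1 * eighthPhase (-1) = 1 := by rw [← eighthPhase_add]; norm_num
  have h5 : eighthPhase (-1) * eighthPhase (-1) = eighthPhase (-2) := by rw [← eighthPhase_add]; norm_num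
  have h7 : eighthPhase 2 * eighthPhase 2 = eighthPhase 4 := by rw [← eighthPhase_add]; norm_num
  have h6 : eighthPhase (-4) * eighthPhase 2 = eighthPhase (-2) := by rw [← eighthPhase_add]; norm_num
  have h8 : eighthPhase (-2) * eighthPhase 2 = 1 := by rw [← eighthPhase_add]; norm_num
  have h9 : eighthPhase 4 * eighthPhase (-2) = eighthPhase 2 := by rw [← eighthPhase_add]; norm_num
  linear_combination (a / 2) * (h7 + (eighthPhase 2 - 1) * h6 + h8 + h9 + (1 + eighthPhase (-4)) * eighthPhase 2 * h2 -
    ((1 + eighthPhase (-4)) * eighthPhase 2 + 1 + eighthPhase 4) * h0 - (1 + eighthPhase 4) * h5)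

end Table

end Literature.Probability.LatticeModels
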